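import Summits.QuantumFields.YangMills.Theorems.FemtoTransferGapAdaptedBasis
import Summits.QuantumFields.YangMills.Theorems.FemtoTransferGapSlabRayleigh
import HarnessLib

/-!
# Femto transfer gap — EXACT SPECTRAL SUMS for the dressed correlators `⟨K_β^m w, K_β^n v⟩` of physical vectors
# (support module for crux `DressedRitz`, stmt-QuantumFields-20205, line «polyakovlift» r6, stub S-PSCAL″; LEAD prover ym-lead-20205-polyakovlift g2)

The one-site shadow clauses (o0′)(o5′)(o6′) are statements about `n_il = ⟨K^L v_i, K^L v_l⟩` and `d_il = ⟨K^L v_i, K^{L+1} v_l⟩` for explicit physical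
vectors `v_i`.  This file turns them into EXACT series over ONE physical orthonormal eigen-sequence `e_k` of the zero-flux transfer operator
(`K_β e_k = λ_k e_k`, `λ_k = levelValue su2Rep L β k`; tree `exists_hilbertBasis_adapted`):

* ★ `exists_spectral_eigenseq` — for `β > 0` there is `e : ℕ → physSubmodule L`, `l2`-orthonormal exact eigenfunctions with Courant–Fischer domination, such
  that for all PHYSICAL `v, w` and all `m + n ≥ 1`:  `HasSum (k ↦ λ_k^{m+n} · ⟨w,e_k⟩ · ⟨v,e_k⟩) ⟨K^[m] w, K^[n] v⟩`, together with Bessel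
  `Σ_k ⟨v,e_k⟩² ≤ ⟨v,v⟩` (summable).  (Completeness modulo the kernel: the part of `v` outside the closed span of the `e_k` is annihilated by `K`, so it is
  invisible at every positive time separation.)

Mechanism: the `L²` Hilbert basis adapted to `K_β` (`exists_hilbertBasis_adapted`: the classes of the `e_k` plus vectors `x = y + (x − y)`, `y` physical with
`∫K y = 0`, `x − y ⊥ physL2`), Parseval `⟪u, z⟫ = Σ_i ⟪u,b_i⟫⟪b_i,z⟫` at `z = A v` (`A` the `L²` kernel operator), where the non-`e_k` terms vanish, and
induction on the power.

HONEST FRAMING: functional-analysis plumbing on a fixed lattice (any `L`, `β > 0`); nothing here bears on infinite volume, the continuum limit or the Clay gap.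
References: Reed–Simon I, Thm. VI.16 [cite: ReedSimonI1980, Thm. VI.16]; Reed–Simon IV, Thm. XIII.1 [cite: ReedSimonIV1978, Thm. XIII.1].
-/

set_option autoImplicit false

noncomputable section

open MeasureTheory Filter Topology Real
open scoped RealInnerProductSpace BigOperators
open Literature.MathematicalPhysics.QuantumFieldTheory
open Literature.MathematicalPhysics.QuantumLattice

namespace Summit.QuantumFields.YangMills.Theorems.FemtoTransferGap

namespace SpecSum

open PhysL2

variable {L : ℕ} [NeZero L]

/-! ### §1. `L²` level: Parseval against the adapted Hilbert basis -/

/-- Iterates of the physical endomorphism are iterates of `transferApply` on representatives. [folklore] -/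
theorem coe_transferOp_iterate (β : ℝ) (n : ℕ) (ψ : physSubmodule L) :
    (((transferOp β)^[n] ψ : physSubmodule L) : GaugeConfig 3 L SU2 → ℝ) = (transferApply β)^[n] (ψ : GaugeConfig 3 L SU2 → ℝ) := by
  induction n generalizing ψ with
  | zero => rfl
  | succ n ih => rw [Function.iterate_succ_apply, Function.iterate_succ_apply, ih]; rfl

/-- `A^[n] (toL2 ψ) = toL2 (transferOp^[n] ψ)`. [folklore] -/
theorem iterate_apply_toL2 {β : ℝ} {A : Lp ℝ 2 (configMeasure SU2 L) →L[ℝ] Lp ℝ 2 (configMeasure SU2 L)}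
    (hA : ∀ v : Lp ℝ 2 (configMeasure SU2 L),
      (A v : GaugeConfig 3 L SU2 → ℝ) =ᵐ[configMeasure SU2 L] fun U => ∫ V, transferKernel su2Rep β U V * v V ∂configMeasure SU2 L)
    (n : ℕ) (ψ : physSubmodule L) : A^[n] (toL2 ψ) = toL2 ((transferOp β)^[n] ψ) := by
  induction n generalizing ψ with
  | zero => rfl
  | succ n ih => rw [Function.iterate_succ_apply, Function.iterate_succ_apply, apply_toL2 hA, ih]

/-! ### §2. ★ The spectral eigen-sequence with exact dressed sums -/

/-- ★ **Exact spectral sums.**  For `β > 0` there is a physical `l2`-orthonormal exact eigen-sequence `e_k` (`K_β e_k = λ_k e_k`, `λ_k = levelValue su2Rep L β k`,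
Courant–Fischer domination) such that for all physical `v, w` and `m + n ≥ 1`, `⟨K^[m] w, K^[n] v⟩ = Σ_k λ_k^{m+n} ⟨w,e_k⟩⟨v,e_k⟩` (as a `HasSum`), and Bessel
`Σ_k ⟨v,e_k⟩² ≤ ⟨v,v⟩`. [cite: ReedSimonI1980, Thm. VI.16] [cite: ReedSimonIV1978, Thm. XIII.1] -/
theorem exists_spectral_eigenseq {β : ℝ} (hβ : 0 < β) :
    ∃ e : ℕ → physSubmodule L,
      (∀ i l, l2 ((e i : physSubmodule L) : GaugeConfig 3 L SU2 → ℝ) (e l) = if i = l then 1 else 0) ∧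
      (∀ k, transferApply β ((e k : physSubmodule L) : GaugeConfig 3 L SU2 → ℝ) =
        levelValue su2Rep L β k • ((e k : physSubmodule L) : GaugeConfig 3 L SU2 → ℝ)) ∧
      (∀ (k : ℕ) (ψ : GaugeConfig 3 L SU2 → ℝ), IsPhys ψ →
        (∀ i, i < k → l2 ψ ((e i : physSubmodule L) : GaugeConfig 3 L SU2 → ℝ) = 0) →
          qform su2Rep β ψ ψ ≤ levelValue su2Rep L β k * l2 ψ ψ) ∧
      (∀ (v w : GaugeConfig 3 L SU2 → ℝ), IsPhys v → IsPhys w → ∀ m n : ℕ, 1 ≤ m + n →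
        HasSum (fun k => levelValue su2Rep L β k ^ (m + n) *
            l2 w ((e k : physSubmodule L) : GaugeConfig 3 L SU2 → ℝ) * l2 v ((e k : physSubmodule L) : GaugeConfig 3 L SU2 → ℝ))
          (l2 ((transferApply β)^[m] w) ((transferApply β)^[n] v))) ∧
      (∀ v : GaugeConfig 3 L SU2 → ℝ, IsPhys v →
        Summable (fun k => l2 v ((e k : physSubmodule L) : GaugeConfig 3 L SU2 → ℝ) ^ 2) ∧
          ∑' k, l2 v ((e k : physSubmodule L) : GaugeConfig 3 L SU2 → ℝ) ^ 2 ≤ l2 v v) := by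
  classical
  obtain ⟨e, w, b, hon, heig, hdom, hsw, hb, hrest⟩ := exists_hilbertBasis_adapted (L := L) hβ
  obtain ⟨A, hA, hsa, -⟩ := exists_transferOpL2 (L := L) β
  haveI : CompleteSpace (physL2 L) := isClosed_physL2.completeSpace_coe
  -- notation: the classes of the eigenfunctions
  set et : ℕ → Lp ℝ 2 (configMeasure SU2 L) := fun k => toL2 (e k) with het
  have honL2 : Orthonormal ℝ et := by
    rw [orthonormal_iff_ite]; intro i l; rw [het, inner_toL2]; exact hon i l
  have hinj : Function.Injective et := honL2.linearIndependent.injective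
  have hsym : ∀ x y : Lp ℝ 2 (configMeasure SU2 L), ⟪A x, y⟫ = ⟪x, A y⟫ :=
    fun x y => (ContinuousLinearMap.isSelfAdjoint_iff_isSymmetric.1 hsa) x y
  have hAe : ∀ k, A (et k) = levelValue su2Rep L β k • et k := fun k => by
    have hk : transferOp β (e k) = levelValue su2Rep L β k • e k :=
      Subtype.ext (by rw [coe_transferOp, heig k, Submodule.coe_smul])
    rw [het, apply_toL2 hA, hk, map_smul]
  -- moving iterates across the inner product
  have hmove : ∀ (j : ℕ) (x y : Lp ℝ 2 (configMeasure SU2 L)), ⟪A^[j] x, y⟫ = ⟪x, A^[j] y⟫ := by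
    intro j; induction j with
    | zero => intro x y; rfl
    | succ j ih =>
      intro x y
      rw [Function.iterate_succ_apply', hsym, ih, ← Function.iterate_succ_apply A j y]
  -- the index embedding `ℕ → w`
  let g : ℕ → w := fun k => ⟨et k, hsw ⟨k, rfl⟩⟩
  have hg : Function.Injective g := fun k l h => hinj (congrArg Subtype.val h)
  -- (1) Parseval at `z = A v`, `v ∈ physL2`: the non-`e` terms vanish
  have hpars : ∀ (u v : Lp ℝ 2 (configMeasure SU2 L)), v ∈ physL2 L →
      HasSum (fun k => levelValue su2Rep L β k * ⟪u, et k⟫ * ⟪et k, v⟫) ⟪u, A v⟫ := by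
    intro u v hv
    have h1 := b.hasSum_inner_mul_inner u (A v)
    have hzero : ∀ x : w, x ∉ Set.range g → (fun i : w => ⟪u, b i⟫ * ⟪b i, A v⟫) x = 0 := by
      intro x hx
      have hxs : (x : Lp ℝ 2 (configMeasure SU2 L)) ∉ Set.range (fun k => toL2 (e k)) := by
        rintro ⟨k, hk⟩
        exact hx ⟨k, Subtype.ext hk⟩
      obtain ⟨y, hy, hxy, hy0⟩ := hrest x x.2 hxs
      have hAy : A y = 0 := by
        apply Lp.ext
        filter_upwards [hA y, Lp.coeFn_zero ℝ 2 (configMeasure SU2 L)] with U h3 h4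
        rw [h3, h4, Pi.zero_apply]
        exact hy0 U
      have hbx : b x = (x : Lp ℝ 2 (configMeasure SU2 L)) := by rw [hb]
      have : ⟪(x : Lp ℝ 2 (configMeasure SU2 L)), A v⟫ = 0 := by
        have hsplit : (x : Lp ℝ 2 (configMeasure SU2 L)) = y + ((x : Lp ℝ 2 (configMeasure SU2 L)) - y) := by abel
        rw [hsplit, inner_add_left, ← hsym, hAy, inner_zero_left, zero_add]
        exact Submodule.inner_left_of_mem_orthogonal (apply_mem_physL2 hA hv) hxy
      simp only [hbx, this, mul_zero]
    have h2 := (hg.hasSum_iff hzero).2 h1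
    refine h2.congr_fun fun k => ?_
    change _ = ⟪u, b (g k)⟫ * ⟪b (g k), A v⟫
    have hbg : b (g k) = et k := by rw [hb]
    rw [hbg, ← hsym, hAe, inner_smul_left]
    simp only [conj_trivial]
    ring
  -- (2) `⟪et k, A^[n] v⟫ = λ_k^n ⟪et k, v⟫`
  have hiter_mem : ∀ (n : ℕ) (v : Lp ℝ 2 (configMeasure SU2 L)), v ∈ physL2 L → A^[n] v ∈ physL2 L := by
    intro n; induction n with
    | zero => intro v hv; exact hv
    | succ n ih => intro v hv; rw [Function.iterate_succ_apply']; exact apply_mem_physL2 hA (ih v hv)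
  have heiter : ∀ (n : ℕ) (k : ℕ) (v : Lp ℝ 2 (configMeasure SU2 L)), ⟪et k, A^[n] v⟫ = levelValue su2Rep L β k ^ n * ⟪et k, v⟫ := by
    intro n; induction n with
    | zero => intro k v; simp
    | succ n ih =>
      intro k v
      rw [Function.iterate_succ_apply', ← hsym, hAe, inner_smul_left, ih, pow_succ]
      simp only [conj_trivial]; ring
  -- (3) all powers, both slots
  have hpow : ∀ (u v : Lp ℝ 2 (configMeasure SU2 L)), v ∈ physL2 L → ∀ m n : ℕ, 1 ≤ m + n →
      HasSum (fun k => levelValue su2Rep L β k ^ (m + n) * ⟪u, et k⟫ * ⟪et k, v⟫) ⟪A^[m] u, A^[n] v⟫ := by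
    intro u v hv m n hmn
    obtain ⟨j, hj⟩ : ∃ j, m + n = j + 1 := ⟨m + n - 1, by omega⟩
    rw [hmove, ← Function.iterate_add_apply, hj, Function.iterate_succ_apply']
    have h := hpars u (A^[j] v) (hiter_mem j v hv)
    refine h.congr_fun fun k => ?_
    rw [heiter, pow_succ]; ring
  refine ⟨e, hon, heig, hdom, fun v w' hv hw m n hmn => ?_, fun v hv => ?_⟩
  · -- function level
    set vp : physSubmodule L := ⟨v, hv⟩
    set wp : physSubmodule L := ⟨w', hw⟩
    have h := hpow (toL2 wp) (toL2 vp) (toL2_mem_physL2 vp) m n hmn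
    have hval : ⟪A^[m] (toL2 wp), A^[n] (toL2 vp)⟫ = l2 ((transferApply β)^[m] w') ((transferApply β)^[n] v) := by
      rw [iterate_apply_toL2 hA, iterate_apply_toL2 hA, inner_toL2, coe_transferOp_iterate, coe_transferOp_iterate]
    rw [hval] at h
    refine h.congr_fun fun k => ?_
    rw [het, inner_toL2, inner_toL2, l2_comm ((e k : physSubmodule L) : GaugeConfig 3 L SU2 → ℝ) v]
  · -- Bessel
    set vp : physSubmodule L := ⟨v, hv⟩
    have hs := honL2.inner_products_summable (x := toL2 vp)
    have hle := honL2.tsum_inner_products_le (x := toL2 vp)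
    have hterm : ∀ k, ‖⟪et k, toL2 vp⟫‖ ^ 2 = l2 v ((e k : physSubmodule L) : GaugeConfig 3 L SU2 → ℝ) ^ 2 := by
      intro k
      rw [Real.norm_eq_abs, sq_abs, het, inner_toL2, l2_comm]
    simp only [hterm] at hs hle
    rw [norm_sq_toL2] at hle
    exact ⟨hs, hle⟩

end SpecSum

end Summit.QuantumFields.YangMills.Theorems.FemtoTransferGap

end
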